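import Literature.Analysis.FluidPDE.TaoAveragedComplexAverage
import Literature.Analysis.FluidPDE.TaoAveragedConjugation
import HarnessLib

/-!
# Tao's averaged Navier–Stokes blow-up: discharge of `memH10dfC_decomposition`

T. Tao, *Finite time blowup for an averaged three-dimensional Navier–Stokes equation*,
J. Amer. Math. Soc. **29** (2016), 601–674 = arXiv:1402.0290v3 (held as `paper:arxiv-1402.0290`;
page numbers are those of that text). §2 (Notation), p. 13: "for instance `V ⊗ ℂ` is the
complexification of `V`, that is to say the space of formal linear combinations `v₁ + i v₂` with
`v₁, v₂ ∈ V`"; §1.1 p. 6 and §3.1 (Definition 3.4) p. 15: the complexified operators act on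
`H¹⁰_df(ℝ³) ⊗ ℂ`.

The named fact `Literature.Analysis.FluidPDE.Tao2016.memH10dfC_decomposition`
(`TaoAveragedComplexAverage.lean`) records that the tree's intrinsic description of the
complexified class — `MemH10dfC w`: finite `H¹⁰` norm and `ξ · ŵ(ξ) = 0` a.e., realness dropped
(`TaoAveragedCascade.lean`) — *is* Tao's `H¹⁰_df ⊗ ℂ = {w₁ + i w₂ : w₁, w₂ ∈ H¹⁰_df}`: every such
`w` splits as `Re w + i Im w` with both parts real, of finite `H¹⁰` norm and divergence free.
The analysis behind it — the conjugation symmetry `𝓕(ū)(ξ) = \overline{𝓕u(-ξ)}` of Mathlib's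
`L²` Fourier transform `MeasureTheory.Lp.fourierTransformₗᵢ` (by Schwartz density), evenness of
the Sobolev weight, and `ξ · \overline{ŵ(-ξ)} = \overline{ξ · ŵ(-ξ)}` — is the accepted file
`TaoAveragedConjugation.lean`, whose `MemH10dfC.decompose` is the fact in explicit form
(`w₁ = reL2 w = (w + w̄)/2`, `w₂ = imL2 w = (i/2)(w̄ - w)`). This file only assembles the
discharge `memH10dfC_decomposition_holds`, in a sibling module so that neither accepted file
changes its imports (`TaoAveragedConjugation.lean` does not import the file of the `def`).

## References

* T. Tao, J. Amer. Math. Soc. 29 (2016), 601–674, arXiv:1402.0290v3: §2 p. 13 (`V ⊗ ℂ`),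
  §1.1 p. 6, §3.1 Def. 3.4 p. 15. Key `Tao2016AveragedNS`.
* L. Grafakos, *Classical Fourier Analysis*, 3rd ed., Prop. 2.2.11 (5)
  (`\widehat{\bar f}(ξ) = \overline{\hat f(-ξ)}`).
-/

noncomputable section

namespace Literature.Analysis.FluidPDE.Tao2016

/-- **`H¹⁰_df ⊗ ℂ = H¹⁰_df ⊕ i H¹⁰_df`, discharged**: every `w ∈ L²(ℝ³; ℂ³)` with finite `H¹⁰`
norm and `ξ · ŵ(ξ) = 0` a.e. (`MemH10dfC w`) is `w₁ + i w₂` with `w₁ = Re w`, `w₂ = Im w ∈ H¹⁰_df`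
(real, finite `H¹⁰` norm, divergence free) — Tao's reading of the complexification,
"`V ⊗ ℂ` … is the space of formal linear combinations `v₁ + i v₂` with `v₁, v₂ ∈ V`" (§2, p. 13),
applied to `V = H¹⁰_df(ℝ³)` (§1.1 p. 6, §3.1 Def. 3.4 p. 15). Proof: `MemH10dfC.decompose`
(`TaoAveragedConjugation.lean`: conjugation symmetry of the `L²` Fourier transform, even Sobolev
weight, `ξ · \overline{ŵ(-ξ)} = 0`). [cite: Tao2016AveragedNS, §2 p. 13 and §3.1 Def. 3.4 p. 15] -/
theorem memH10dfC_decomposition_holds : memH10dfC_decomposition :=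
  fun _ hw => hw.decompose

/-- The decomposition with its witnesses named: `w = Re w + i Im w` with
`Re w = reL2 w`, `Im w = imL2 w ∈ H¹⁰_df` for `w ∈ H¹⁰_df ⊗ ℂ`. [cite: Tao2016AveragedNS, §2 p. 13 and §3.1 Def. 3.4 p. 15] -/
theorem MemH10dfC.eq_reL2_add_I_smul_imL2 {w : L2C} (hw : MemH10dfC w) :
    MemH10df (reL2 w) ∧ MemH10df (imL2 w) ∧ w = reL2 w + Complex.I • imL2 w :=
  ⟨hw.memH10df_reL2, hw.memH10df_imL2, (reL2_add_I_smul_imL2 w).symm⟩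

end Literature.Analysis.FluidPDE.Tao2016
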